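import Summits.BirchSwinnertonDyer.BirchSwinnertonDyer.Theorems.PrintCf2DisegniPairTwoChiLineFactorisationMinusEight
import Literature.NumberTheory.EllipticCurves.PAdicLFunctionMinusIntegralityAtTwoProofs
import HarnessLib

/-!
# Road (C) `disegni-pair-two` on crux stmt-BirchSwinnertonDyer-20368 — VALUES and the LEADING COEFFICIENT
# of Disegni's function on the `χ₋₈ ∘ N`-line at `p = 2` (`d* = −2`):
# `[T¹]G = −c⁻ · L₂⁻′(E, ω, −2) · L₂⁻(E^{(d_K)}, ω, −2)` when `L₂⁻(E, ω, −2) = 0`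

Cell `bsd-print-cf2`, width seat `bsd-line-cf2-p1-w8` g21; sequel to `…ChiLineFactorisationMinusEight`
(`chi8'Line_eq_C_mul_map`: `G = c⁻·H♯`, `H(z) = P⁻(−2−z)`, `P⁻ = L₂⁻(E,ω,T)·L₂⁻(E′,ω,T)`), the `d* = −2`
twin of `…ChiLineLeadingCoeff` (`d* = 2`). THEOREMS ONLY (no `def`, no named fact, no `sorry`);
`--supports stmt-BirchSwinnertonDyer-20368`. BSD is not proved by any of this; no summit statement is
claimed.

* `hasLineValueAt_chi8'Line` — `G(z) = c⁻ · L₂⁻(E,ω,−2−z) · L₂⁻(E′,ω,−2−z)` for `‖z‖ < 1`;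
* `constantCoeff_chi8'Line_eq` — `G(0) = c⁻ · L₂⁻(E,ω,−2) · L₂⁻(E′,ω,−2)`;
* `coeff_one_chi8'Line_eq` — `[T¹]G = −c⁻ · P⁻′(−2)`;
* `coeff_one_chi8'Line_eq_of_hasSum_zero` — ★★★ if `L₂⁻(E,ω,−2) = 0` then
  `[T¹]G = −c⁻ · L₂⁻′(E,ω,−2) · L₂⁻(E′,ω,−2)` («`ord₂ G′_χ(0) = D + a`» for `d* = −2`).

Ingredients: the factorisation; `2`-integrality of the odd branches
(`padicLFunctionMinusBranch_integral_two_of_isNewformOf`, hence `Λ ⊗ ℚ₂`); `MemIwasawaRat.hasSum_eval_mul`;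
`PowerSeries.derivativeFun_mul`; `Σ_k k a_k x^{k−1} = Σ_n [Tⁿ]F′ xⁿ` (`hasSum_nat_add_iff`).

References: Disegni 2017 Thm. A (arXiv v3 PDF pp. 6–8), Lemma 10.2.1–10.2.2 (p. 68); Mazur–Tate–Teitelbaum 1986
§I.11–I.14; Perrin-Riou 1987 (1.1) (p. 459); Robert 2000 Ch. 6 §1.5, §4.2; cell PREGRADE §5.
-/

set_option autoImplicit false
set_option linter.dupNamespace false

noncomputable section

open scoped Classical MatrixGroups ModularForm NumberField

open CongruenceSubgroup NumberField IsDedekindDomain WeierstrassCurve Literature.NumberTheory.EllipticCurves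
  Literature.NumberTheory.EllipticCurves.ModularForms
  Literature.NumberTheory.EllipticCurves.Disegni2017 Literature.NumberTheory.GaloisRepresentations
  Summit.BirchSwinnertonDyer.Rank1Residual.Additive

namespace Summit.BirchSwinnertonDyer.BirchSwinnertonDyer.Theorems.PrintCf2.DisegniPairTwo

section LeadingCoeffMinusEight

/-! ### §0 Evaluation plumbing over `ℚ₂` -/

/-- A series with bounded coefficients converges at a point of the open unit disc of `ℚ_p`. [folklore] -/
private theorem summable_coeff_mul_pow_of_le₈ {p : ℕ} [Fact p.Prime] {F : PowerSeries ℚ_[p]} {C : ℝ}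
    (hF : ∀ k, ‖PowerSeries.coeff k F‖ ≤ C) {a : ℚ_[p]} (ha : ‖a‖ < 1) :
    Summable (fun k : ℕ ↦ PowerSeries.coeff k F * a ^ k) := by
  refine Summable.of_norm_bounded ((summable_geometric_of_lt_one (norm_nonneg _) ha).mul_left C)
    fun k ↦ ?_
  rw [norm_mul, norm_pow]
  exact mul_le_mul_of_nonneg_right (hF k) (pow_nonneg (norm_nonneg _) _)

/-- Transport of an evaluation from `ℚ_p` to `ℂ_p` along the (continuous) embedding. [folklore] -/
private theorem hasSum_algebraMap_coeff_mul_pow₈ {p : ℕ} [Fact p.Prime] {F : PowerSeries ℚ_[p]}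
    {a s : ℚ_[p]} (h : HasSum (fun k : ℕ ↦ PowerSeries.coeff k F * a ^ k) s) :
    HasSum (fun k : ℕ ↦ algebraMap ℚ_[p] ℂ_[p] (PowerSeries.coeff k F) * (algebraMap ℚ_[p] ℂ_[p] a) ^ k)
      (algebraMap ℚ_[p] ℂ_[p] s) := by
  have h' := h.map (algebraMap ℚ_[p] ℂ_[p]) (continuous_algebraMap ℚ_[p] ℂ_[p])
  refine h'.congr_fun fun k ↦ ?_
  simp only [Function.comp_apply, map_mul, map_pow]

/-- The formal derivative of a bounded series is bounded (`‖n+1‖ ≤ 1`). [folklore] -/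
private theorem norm_coeff_derivativeFun_le₈ {p : ℕ} [Fact p.Prime] {F : PowerSeries ℚ_[p]} {C : ℝ}
    (hF : ∀ k, ‖PowerSeries.coeff k F‖ ≤ C) (n : ℕ) :
    ‖PowerSeries.coeff n F.derivativeFun‖ ≤ C := by
  have hC : 0 ≤ C := (norm_nonneg _).trans (hF 0)
  rw [PowerSeries.coeff_derivativeFun, norm_mul, show ((n : ℚ_[p]) + 1) = ((n + 1 : ℕ) : ℚ_[p]) by
    push_cast; ring]
  calc ‖PowerSeries.coeff (n + 1) F‖ * ‖((n + 1 : ℕ) : ℚ_[p])‖ ≤ C * 1 :=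
        mul_le_mul (hF _) (IsUltrametricDist.norm_natCast_le_one ℚ_[p] _) (norm_nonneg _) hC
    _ = C := mul_one C

/-- **Re-indexing the derivative**: `Σ_k k·F_k·a^{k−1} = Σ_n [Tⁿ]F′ · aⁿ` (`[Tⁿ]F′ = (n+1)F_{n+1}`; the `k = 0`
term vanishes). [folklore] -/
private theorem hasSum_derivativeFun_iff₈ {p : ℕ} [Fact p.Prime] {F : PowerSeries ℚ_[p]} {a s : ℚ_[p]} :
    HasSum (fun n : ℕ ↦ PowerSeries.coeff n F.derivativeFun * a ^ n) s ↔
      HasSum (fun k : ℕ ↦ PowerSeries.coeff k F * (k : ℚ_[p]) * a ^ (k - 1)) s := by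
  have h := hasSum_nat_add_iff (f := fun k : ℕ ↦ PowerSeries.coeff k F * (k : ℚ_[p]) * a ^ (k - 1)) 1
    (g := s)
  simp only [Finset.sum_range_one, Nat.cast_zero, mul_zero, zero_mul, add_zero] at h
  rw [← h]
  have hfun : (fun n : ℕ ↦ PowerSeries.coeff n F.derivativeFun * a ^ n) =
      fun n : ℕ ↦ PowerSeries.coeff (n + 1) F * (((n + 1 : ℕ)) : ℚ_[p]) * a ^ (n + 1 - 1) := by
    funext n
    rw [PowerSeries.coeff_derivativeFun, Nat.cast_succ, Nat.add_sub_cancel]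
  rw [hfun]

variable (ι : PadicAlgCl 2 ≃+* ℂ) (K : Type) [Field K] [NumberField K] [IsGalois ℚ K]

/-- `ι₂(−2) = −2`. [folklore] -/
private theorem algebraMap_neg_two₈ : algebraMap ℚ_[2] ℂ_[2] (-2) = -2 := by
  rw [map_neg, map_ofNat]

/-- `‖−2‖₂ < 1`. [folklore] -/
private theorem norm_neg_two_lt_one₈ : ‖(-2 : ℚ_[2])‖ < 1 := by
  rw [norm_neg, show (2 : ℚ_[2]) = ((2 : ℕ) : ℚ_[2]) by norm_num, Padic.norm_p]
  norm_num

/-- `‖−2 − z‖ < 1` for `‖z‖ < 1` in `ℂ₂`. [folklore] -/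
private theorem norm_neg_two_sub_lt_one₈ {z : ℂ_[2]} (hz : ‖z‖ < 1) : ‖(-2 - z : ℂ_[2])‖ < 1 := by
  rw [← algebraMap_neg_two₈, sub_eq_add_neg]
  refine lt_of_le_of_lt (IsUltrametricDist.norm_add_le_max _ _) (max_lt ?_ (by rwa [norm_neg]))
  rw [norm_algebraMap']; exact norm_neg_two_lt_one₈

/-! ### §1 Values and the constant term on the `χ₋₈∘N`-line -/

/-- ★ **`G(z) = c⁻ · L₂⁻(E, ω, −2−z) · L₂⁻(E′, ω, −2−z)` on the open disc** (setting of
`chi8'Line_eq_C_mul_map`, the `χ₋₈∘N`-line): for `z ∈ ℂ₂`, `‖z‖ < 1`, and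
`e₁ = Σ_k ι₂([T^k]L₂⁻(E,ω,T))(−2−z)^k`, `e₂ = Σ_k ι₂([T^k]L₂⁻(E′,ω,T))(−2−z)^k`, Disegni's line function has
the value `c⁻·e₁·e₂` at `z` (`HasLineValueAt`). [cite: Disegni2017, Theorem A (arXiv v3 PDF pp. 6–8)]
[cite: MazurTateTeitelbaum1986Invent, §I.13–I.14] [cite: PerrinRiou1987, (1.1) (p. 459)] -/
theorem hasLineValueAt_chi8'Line (h2 : Module.finrank ℚ K = 2)
    (hsplit : ((Ideal.span {(2 : ℤ)}).primesOver (𝓞 K)).ncard = 2)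
    (𝔭 𝔭' : HeightOneSpectrum (𝓞 K)) (h𝔭 : ((2 : ℕ) : 𝓞 K) ∈ 𝔭.asIdeal)
    (h𝔭' : ((2 : ℕ) : 𝓞 K) ∈ 𝔭'.asIdeal)
    (κ : DirichletCharacter ℂ (NumberField.discr K).natAbs)
    (hκ : ∀ ℓ : ℕ, ℓ.Prime → ℓ ≠ 2 → κ ℓ = (jacobiSym (NumberField.discr K) ℓ : ℂ))
    (hκ2 : κ 2 = if NumberField.discr K % 8 = 1 then 1
        else if NumberField.discr K % 8 = 5 then -1 else 0)
    (hd : Nat.Coprime 2 (NumberField.discr K).natAbs)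
    (V V' : WeierstrassCurve ℚ) [V.IsElliptic] [V.IsGloballyMinimal] [V'.IsElliptic] [V'.IsGloballyMinimal]
    (hordV : IsOrdinaryAt V 2) (hordV' : IsOrdinaryAt V' 2) (hap : V'.frobeniusTrace 2 = V.frobeniusTrace 2)
    {N N' : ℕ} [NeZero N] [NeZero N'] {f : CuspForm (Gamma0 N) 2}
    {f' : CuspForm (Gamma0 N') 2} (hfV : IsNewformOf V f) (hfV' : IsNewformOf V' f')
    (hV' : ∀ n : ℕ, cuspCoeff f' n = κ (n : ZMod _) * cuspCoeff f n)
    {Car : ℝ} {G : PowerSeries ℂ_[2]}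
    (hG : ChiLineInterpolation ι K f (ι (((unitRoot V 2 : ℚ_[2]) : PadicAlgCl 2)))
      (baseChangeDirichlet K (ZMod.χ₈'.ringHomComp (Int.castRingHom ℂ))) 𝔭 𝔭' Car G)
    {z : ℂ_[2]} (hz : ‖z‖ < 1) {e₁ e₂ : ℂ_[2]}
    (he₁ : HasSum (fun k : ℕ ↦ algebraMap ℚ_[2] ℂ_[2]
      (PowerSeries.coeff k (padicLFunctionMinusBranch f (unitRoot V 2 : ℚ_[2]) 1)) * (-2 - z) ^ k) e₁)
    (he₂ : HasSum (fun k : ℕ ↦ algebraMap ℚ_[2] ℂ_[2]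
      (PowerSeries.coeff k (padicLFunctionMinusBranch f' (unitRoot V 2 : ℚ_[2]) 1)) * (-2 - z) ^ k) e₂) :
    HasLineValueAt G z
      (((ι.symm (-(splitLocalConstant 2 : ℂ) * (Car : ℂ) * (minusPeriod f : ℂ) * (minusPeriod f' : ℂ)) :
          PadicAlgCl 2) : ℂ_[2]) * e₁ * e₂) := by
  obtain ⟨H, hGH, -, -, hHev⟩ := chi8'Line_eq_C_mul_map ι K h2 hsplit 𝔭 𝔭' h𝔭 h𝔭' κ hκ hκ2 hd V V' hordV
    hordV' hap hfV hfV' hV' hG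
  have hα' : (unitRoot V' 2 : ℚ_[2]) = (unitRoot V 2 : ℚ_[2]) := by
    rw [show unitRoot V' 2 = unitRoot V 2 by unfold unitRoot; rw [hap]]
  have hC₁ : ∀ k, ‖PowerSeries.coeff k (padicLFunctionMinusBranch f (unitRoot V 2 : ℚ_[2]) 1)‖ ≤ 1 :=
    fun k ↦ padicLFunctionMinusBranch_integral_two_of_isNewformOf hordV hfV odd_one k
  have hC₂ : ∀ k, ‖PowerSeries.coeff k (padicLFunctionMinusBranch f' (unitRoot V 2 : ℚ_[2]) 1)‖ ≤ 1 := by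
    intro k
    have h := padicLFunctionMinusBranch_integral_two_of_isNewformOf hordV' hfV' odd_one k
    rwa [hα'] at h
  have hprod := MemIwasawaRat.hasSum_eval_mul (memIwasawaRat_of_forall_norm_coeff_le hC₁)
    (memIwasawaRat_of_forall_norm_coeff_le hC₂) (norm_neg_two_sub_lt_one₈ hz) he₁ he₂
  have hH := hHev z hz
  rw [hprod.tsum_eq] at hH
  have hcoeff : ∀ j, PowerSeries.coeff j G =
      ((ι.symm (-(splitLocalConstant 2 : ℂ) * (Car : ℂ) * (minusPeriod f : ℂ) * (minusPeriod f' : ℂ)) :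
          PadicAlgCl 2) : ℂ_[2]) * algebraMap ℚ_[2] ℂ_[2] (PowerSeries.coeff j H) := by
    intro j
    rw [hGH, PowerSeries.coeff_C_mul, PowerSeries.coeff_map]
  unfold HasLineValueAt
  have hfun : (fun j : ℕ ↦ PowerSeries.coeff j G * z ^ j) = fun j : ℕ ↦
      ((ι.symm (-(splitLocalConstant 2 : ℂ) * (Car : ℂ) * (minusPeriod f : ℂ) * (minusPeriod f' : ℂ)) :
          PadicAlgCl 2) : ℂ_[2]) * (algebraMap ℚ_[2] ℂ_[2] (PowerSeries.coeff j H) * z ^ j) := by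
    funext j
    rw [hcoeff, mul_assoc]
  rw [hfun]
  simpa only [mul_assoc] using hH.mul_left
    (((ι.symm (-(splitLocalConstant 2 : ℂ) * (Car : ℂ) * (minusPeriod f : ℂ) * (minusPeriod f' : ℂ)) :
      PadicAlgCl 2) : ℂ_[2]))

/-- ★ **`G(0) = c⁻ · L₂⁻(E, ω, −2) · L₂⁻(E′, ω, −2)`**: the constant coefficient of Disegni's function on
the `χ₋₈∘N`-line — Theorem A AT `χ₋₈∘N` — is `c⁻` times the two odd-branch Mazur–Tate–Teitelbaum functions
at the point `T = −2` of the character `χ_{χ₈}` (`χ₈·ω = χ₋₈`).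
[cite: Disegni2017, Theorem A (arXiv v3 PDF pp. 6–8)] [cite: MazurTateTeitelbaum1986Invent, §I.14 (14.3)] -/
theorem constantCoeff_chi8'Line_eq (h2 : Module.finrank ℚ K = 2)
    (hsplit : ((Ideal.span {(2 : ℤ)}).primesOver (𝓞 K)).ncard = 2)
    (𝔭 𝔭' : HeightOneSpectrum (𝓞 K)) (h𝔭 : ((2 : ℕ) : 𝓞 K) ∈ 𝔭.asIdeal)
    (h𝔭' : ((2 : ℕ) : 𝓞 K) ∈ 𝔭'.asIdeal)
    (κ : DirichletCharacter ℂ (NumberField.discr K).natAbs)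
    (hκ : ∀ ℓ : ℕ, ℓ.Prime → ℓ ≠ 2 → κ ℓ = (jacobiSym (NumberField.discr K) ℓ : ℂ))
    (hκ2 : κ 2 = if NumberField.discr K % 8 = 1 then 1
        else if NumberField.discr K % 8 = 5 then -1 else 0)
    (hd : Nat.Coprime 2 (NumberField.discr K).natAbs)
    (V V' : WeierstrassCurve ℚ) [V.IsElliptic] [V.IsGloballyMinimal] [V'.IsElliptic] [V'.IsGloballyMinimal]
    (hordV : IsOrdinaryAt V 2) (hordV' : IsOrdinaryAt V' 2) (hap : V'.frobeniusTrace 2 = V.frobeniusTrace 2)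
    {N N' : ℕ} [NeZero N] [NeZero N'] {f : CuspForm (Gamma0 N) 2}
    {f' : CuspForm (Gamma0 N') 2} (hfV : IsNewformOf V f) (hfV' : IsNewformOf V' f')
    (hV' : ∀ n : ℕ, cuspCoeff f' n = κ (n : ZMod _) * cuspCoeff f n)
    {Car : ℝ} {G : PowerSeries ℂ_[2]}
    (hG : ChiLineInterpolation ι K f (ι (((unitRoot V 2 : ℚ_[2]) : PadicAlgCl 2)))
      (baseChangeDirichlet K (ZMod.χ₈'.ringHomComp (Int.castRingHom ℂ))) 𝔭 𝔭' Car G)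
    {e₁ e₂ : ℂ_[2]}
    (he₁ : HasSum (fun k : ℕ ↦ algebraMap ℚ_[2] ℂ_[2]
      (PowerSeries.coeff k (padicLFunctionMinusBranch f (unitRoot V 2 : ℚ_[2]) 1)) * (-2) ^ k) e₁)
    (he₂ : HasSum (fun k : ℕ ↦ algebraMap ℚ_[2] ℂ_[2]
      (PowerSeries.coeff k (padicLFunctionMinusBranch f' (unitRoot V 2 : ℚ_[2]) 1)) * (-2) ^ k) e₂) :
    PowerSeries.constantCoeff G =
      ((ι.symm (-(splitLocalConstant 2 : ℂ) * (Car : ℂ) * (minusPeriod f : ℂ) * (minusPeriod f' : ℂ)) :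
          PadicAlgCl 2) : ℂ_[2]) * e₁ * e₂ := by
  have he₁' : HasSum (fun k : ℕ ↦ algebraMap ℚ_[2] ℂ_[2]
      (PowerSeries.coeff k (padicLFunctionMinusBranch f (unitRoot V 2 : ℚ_[2]) 1)) * (-2 - (0 : ℂ_[2])) ^ k) e₁ := by
    simpa only [sub_zero] using he₁
  have he₂' : HasSum (fun k : ℕ ↦ algebraMap ℚ_[2] ℂ_[2]
      (PowerSeries.coeff k (padicLFunctionMinusBranch f' (unitRoot V 2 : ℚ_[2]) 1)) * (-2 - (0 : ℂ_[2])) ^ k) e₂ := by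
    simpa only [sub_zero] using he₂
  have h := hasLineValueAt_chi8'Line ι K h2 hsplit 𝔭 𝔭' h𝔭 h𝔭' κ hκ hκ2 hd V V' hordV hordV' hap hfV
    hfV' hV' hG (by rw [norm_zero]; exact one_pos) he₁' he₂'
  exact (HasLineValueAt.eq_constantCoeff h).symm

/-! ### §2 The first coefficient -/

/-- ★ **`[T¹]G = −c⁻ · Σ_k k·P⁻_k·(−2)^{k−1} = −c⁻ · P⁻′(−2)`**, `P⁻ = L₂⁻(E,ω,T)·L₂⁻(E′,ω,T)`: the
derivative of Disegni's line function at the base point `χ₋₈∘N` is `−c⁻` times the derivative of the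
product of the two odd-branch Mazur–Tate–Teitelbaum functions at `T = −2` (chain rule for `T ↦ −T−2`).
[cite: Disegni2017, Theorem A (arXiv v3 PDF pp. 6–8)] [cite: MazurTateTeitelbaum1986Invent, §I.13–I.14]
[cite: Robert2000, Ch. 6 §1.5] -/
theorem coeff_one_chi8'Line_eq (h2 : Module.finrank ℚ K = 2)
    (hsplit : ((Ideal.span {(2 : ℤ)}).primesOver (𝓞 K)).ncard = 2)
    (𝔭 𝔭' : HeightOneSpectrum (𝓞 K)) (h𝔭 : ((2 : ℕ) : 𝓞 K) ∈ 𝔭.asIdeal)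
    (h𝔭' : ((2 : ℕ) : 𝓞 K) ∈ 𝔭'.asIdeal)
    (κ : DirichletCharacter ℂ (NumberField.discr K).natAbs)
    (hκ : ∀ ℓ : ℕ, ℓ.Prime → ℓ ≠ 2 → κ ℓ = (jacobiSym (NumberField.discr K) ℓ : ℂ))
    (hκ2 : κ 2 = if NumberField.discr K % 8 = 1 then 1
        else if NumberField.discr K % 8 = 5 then -1 else 0)
    (hd : Nat.Coprime 2 (NumberField.discr K).natAbs)
    (V V' : WeierstrassCurve ℚ) [V.IsElliptic] [V.IsGloballyMinimal] [V'.IsElliptic] [V'.IsGloballyMinimal]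
    (hordV : IsOrdinaryAt V 2) (hordV' : IsOrdinaryAt V' 2) (hap : V'.frobeniusTrace 2 = V.frobeniusTrace 2)
    {N N' : ℕ} [NeZero N] [NeZero N'] {f : CuspForm (Gamma0 N) 2}
    {f' : CuspForm (Gamma0 N') 2} (hfV : IsNewformOf V f) (hfV' : IsNewformOf V' f')
    (hV' : ∀ n : ℕ, cuspCoeff f' n = κ (n : ZMod _) * cuspCoeff f n)
    {Car : ℝ} {G : PowerSeries ℂ_[2]}
    (hG : ChiLineInterpolation ι K f (ι (((unitRoot V 2 : ℚ_[2]) : PadicAlgCl 2)))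
      (baseChangeDirichlet K (ZMod.χ₈'.ringHomComp (Int.castRingHom ℂ))) 𝔭 𝔭' Car G) :
    PowerSeries.coeff 1 G =
      -(((ι.symm (-(splitLocalConstant 2 : ℂ) * (Car : ℂ) * (minusPeriod f : ℂ) * (minusPeriod f' : ℂ)) :
          PadicAlgCl 2) : ℂ_[2]) *
        algebraMap ℚ_[2] ℂ_[2] (∑' k : ℕ, PowerSeries.coeff k
          (padicLFunctionMinusBranch f (unitRoot V 2 : ℚ_[2]) 1 * padicLFunctionMinusBranch f' (unitRoot V 2 : ℚ_[2]) 1) *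
            (k : ℚ_[2]) * (-2) ^ (k - 1))) := by
  obtain ⟨H, hGH, -, hH1, -⟩ := chi8'Line_eq_C_mul_map ι K h2 hsplit 𝔭 𝔭' h𝔭 h𝔭' κ hκ hκ2 hd V V' hordV
    hordV' hap hfV hfV' hV' hG
  rw [hGH, PowerSeries.coeff_C_mul, PowerSeries.coeff_map, ← hH1.tsum_eq, tsum_neg, map_neg, mul_neg]

/-- ★★★ **The rank-one leading coefficient on the `χ₋₈∘N`-line:
`[T¹]G = −c⁻ · L₂⁻′(E, ω, −2) · L₂⁻(E′, ω, −2)` when `L₂⁻(E, ω, −2) = 0`.** In the setting of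
`chi8'Line_eq_C_mul_map`, if the odd branch of `E` vanishes at the point `−2` of `χ_{χ₈}`
(`Σ_k [T^k]L₂⁻(E,ω,T)·(−2)^k = 0`, i.e. `L(E⊗χ₋₈, 1) = 0` by the interpolation (14.3) and Birch — the sign of
the member `W = E ⊗ χ₋₈`), then the first coefficient of Disegni's function is
`−c⁻ · (Σ_k k·[T^k]L₂⁻(E,ω,T)·(−2)^{k−1}) · (Σ_k [T^k]L₂⁻(E′,ω,T)·(−2)^k)` — Leibniz
(`PowerSeries.derivativeFun_mul`) for `P⁻` at `−2` (`MemIwasawaRat.hasSum_eval_mul`), the term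
`L₂⁻(E,ω,−2)·L₂⁻′(E′,ω,−2)` vanishing; the odd branches are `2`-integral unconditionally
(`padicLFunctionMinusBranch_integral_two_of_isNewformOf`). In valuations: «`ord₂ [T¹]G = ord₂ c⁻ + D + a`»,
`D = ord₂ L₂⁻′(E,ω,−2)`, `a = ord₂ L₂⁻(E′,ω,−2)` (cell PREGRADE §5, `d* = −2`). For the crux's class:
`E = 49a1^{(d′)}`, `d′ ≡ 1 (4)`, `W = E ⊗ χ₋₈ = 49a1^{(−2d′)}`.
[cite: Disegni2017, Theorem A/B (arXiv v3 PDF pp. 6–9)] [cite: MazurTateTeitelbaum1986Invent, §I.13–I.14]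
[cite: PerrinRiou1987, (1.1) (p. 459)] -/
theorem coeff_one_chi8'Line_eq_of_hasSum_zero (h2 : Module.finrank ℚ K = 2)
    (hsplit : ((Ideal.span {(2 : ℤ)}).primesOver (𝓞 K)).ncard = 2)
    (𝔭 𝔭' : HeightOneSpectrum (𝓞 K)) (h𝔭 : ((2 : ℕ) : 𝓞 K) ∈ 𝔭.asIdeal)
    (h𝔭' : ((2 : ℕ) : 𝓞 K) ∈ 𝔭'.asIdeal)
    (κ : DirichletCharacter ℂ (NumberField.discr K).natAbs)
    (hκ : ∀ ℓ : ℕ, ℓ.Prime → ℓ ≠ 2 → κ ℓ = (jacobiSym (NumberField.discr K) ℓ : ℂ))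
    (hκ2 : κ 2 = if NumberField.discr K % 8 = 1 then 1
        else if NumberField.discr K % 8 = 5 then -1 else 0)
    (hd : Nat.Coprime 2 (NumberField.discr K).natAbs)
    (V V' : WeierstrassCurve ℚ) [V.IsElliptic] [V.IsGloballyMinimal] [V'.IsElliptic] [V'.IsGloballyMinimal]
    (hordV : IsOrdinaryAt V 2) (hordV' : IsOrdinaryAt V' 2) (hap : V'.frobeniusTrace 2 = V.frobeniusTrace 2)
    {N N' : ℕ} [NeZero N] [NeZero N'] {f : CuspForm (Gamma0 N) 2}
    {f' : CuspForm (Gamma0 N') 2} (hfV : IsNewformOf V f) (hfV' : IsNewformOf V' f')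
    (hV' : ∀ n : ℕ, cuspCoeff f' n = κ (n : ZMod _) * cuspCoeff f n)
    {Car : ℝ} {G : PowerSeries ℂ_[2]}
    (hG : ChiLineInterpolation ι K f (ι (((unitRoot V 2 : ℚ_[2]) : PadicAlgCl 2)))
      (baseChangeDirichlet K (ZMod.χ₈'.ringHomComp (Int.castRingHom ℂ))) 𝔭 𝔭' Car G)
    (h0 : HasSum (fun k : ℕ ↦ PowerSeries.coeff k (padicLFunctionMinusBranch f (unitRoot V 2 : ℚ_[2]) 1) *
      (-2 : ℚ_[2]) ^ k) 0) :
    PowerSeries.coeff 1 G =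
      -(((ι.symm (-(splitLocalConstant 2 : ℂ) * (Car : ℂ) * (minusPeriod f : ℂ) * (minusPeriod f' : ℂ)) :
          PadicAlgCl 2) : ℂ_[2]) *
        algebraMap ℚ_[2] ℂ_[2] (∑' k : ℕ, PowerSeries.coeff k (padicLFunctionMinusBranch f (unitRoot V 2 : ℚ_[2]) 1) *
          (k : ℚ_[2]) * (-2) ^ (k - 1)) *
        algebraMap ℚ_[2] ℂ_[2] (∑' k : ℕ, PowerSeries.coeff k (padicLFunctionMinusBranch f' (unitRoot V 2 : ℚ_[2]) 1) *
          (-2) ^ k)) := by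
  obtain ⟨H, hGH, -, hH1, -⟩ := chi8'Line_eq_C_mul_map ι K h2 hsplit 𝔭 𝔭' h𝔭 h𝔭' κ hκ hκ2 hd V V' hordV
    hordV' hap hfV hfV' hV' hG
  set α : ℚ_[2] := (unitRoot V 2 : ℚ_[2]) with hαdef
  set B₁ := padicLFunctionMinusBranch f α 1 with hB₁
  set B₂ := padicLFunctionMinusBranch f' α 1 with hB₂
  set ι₂ := algebraMap ℚ_[2] ℂ_[2] with hι₂
  set a : ℚ_[2] := -2 with ha
  have ha1 : ‖a‖ < 1 := norm_neg_two_lt_one₈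
  have hα' : (unitRoot V' 2 : ℚ_[2]) = α := by
    rw [hαdef, show unitRoot V' 2 = unitRoot V 2 by unfold unitRoot; rw [hap]]
  -- bounds and `Λ ⊗ ℚ₂`-membership of the four series
  have hC₁ : ∀ k, ‖PowerSeries.coeff k (padicLFunctionMinusBranch f (unitRoot V 2 : ℚ_[2]) 1)‖ ≤ 1 :=
    fun k ↦ padicLFunctionMinusBranch_integral_two_of_isNewformOf hordV hfV odd_one k
  have hC₂ : ∀ k, ‖PowerSeries.coeff k (padicLFunctionMinusBranch f' (unitRoot V 2 : ℚ_[2]) 1)‖ ≤ 1 := by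
    intro k
    have h := padicLFunctionMinusBranch_integral_two_of_isNewformOf hordV' hfV' odd_one k
    rwa [hα'] at h
  have hD₁b := norm_coeff_derivativeFun_le₈ hC₁
  have hD₂b := norm_coeff_derivativeFun_le₈ hC₂
  have hM₁ : MemIwasawaRat 2 B₁ := memIwasawaRat_of_forall_norm_coeff_le hC₁
  have hM₂ : MemIwasawaRat 2 B₂ := memIwasawaRat_of_forall_norm_coeff_le hC₂
  have hMD₁ : MemIwasawaRat 2 B₁.derivativeFun := memIwasawaRat_of_forall_norm_coeff_le hD₁b
  have hMD₂ : MemIwasawaRat 2 B₂.derivativeFun := memIwasawaRat_of_forall_norm_coeff_le hD₂b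
  -- the four evaluations at `a = −2` in `ℚ₂`
  have hs₂ := (summable_coeff_mul_pow_of_le₈ hC₂ ha1).hasSum
  have hd₁ := (summable_coeff_mul_pow_of_le₈ hD₁b ha1).hasSum
  have hd₂ := (summable_coeff_mul_pow_of_le₈ hD₂b ha1).hasSum
  -- in `ℂ₂`
  have hz : ‖ι₂ a‖ < 1 := by rw [hι₂, norm_algebraMap']; exact ha1
  have hv₁ := hasSum_algebraMap_coeff_mul_pow₈ h0
  have hv₂ := hasSum_algebraMap_coeff_mul_pow₈ hs₂
  have hw₁ := hasSum_algebraMap_coeff_mul_pow₈ hd₁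
  have hw₂ := hasSum_algebraMap_coeff_mul_pow₈ hd₂
  rw [map_zero] at hv₁
  -- Leibniz: `P′ = B₁ • B₂′ + B₂ • B₁′`, evaluated at `a`
  have hP₁ := MemIwasawaRat.hasSum_eval_mul hM₁ hMD₂ hz hv₁ hw₂
  have hP₂ := MemIwasawaRat.hasSum_eval_mul hM₂ hMD₁ hz hv₂ hw₁
  have hDP : HasSum (fun k : ℕ ↦ ι₂ (PowerSeries.coeff k (B₁ * B₂).derivativeFun) * (ι₂ a) ^ k)
      (0 * ι₂ (∑' n : ℕ, PowerSeries.coeff n B₂.derivativeFun * a ^ n) +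
        ι₂ (∑' n : ℕ, PowerSeries.coeff n B₂ * a ^ n) *
          ι₂ (∑' n : ℕ, PowerSeries.coeff n B₁.derivativeFun * a ^ n)) := by
    rw [PowerSeries.derivativeFun_mul, smul_eq_mul, smul_eq_mul]
    refine (hP₁.add hP₂).congr_fun fun k ↦ ?_
    rw [map_add, map_add, add_mul]
  -- the same evaluation from the re-centring: `Σ_n [Tⁿ]P′ aⁿ = Σ_k k P_k a^{k−1} = −[T¹]H`
  have hH1' : HasSum (fun n : ℕ ↦ PowerSeries.coeff n (B₁ * B₂).derivativeFun * a ^ n)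
      (-PowerSeries.coeff 1 H) := by
    rw [hasSum_derivativeFun_iff₈]
    have h := hH1.neg
    simp only [neg_neg] at h
    exact h
  have hDP' := hasSum_algebraMap_coeff_mul_pow₈ hH1'
  have huniq := hDP'.unique hDP
  rw [zero_mul, zero_add, map_neg, neg_eq_iff_eq_neg] at huniq
  rw [← hι₂] at huniq
  -- `[T¹]G = c · ι₂([T¹]H)`
  rw [hGH, PowerSeries.coeff_C_mul, PowerSeries.coeff_map, huniq,
    (hasSum_derivativeFun_iff₈.mp hd₁).tsum_eq]
  ring

end LeadingCoeffMinusEight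

end Summit.BirchSwinnertonDyer.BirchSwinnertonDyer.Theorems.PrintCf2.DisegniPairTwo

end
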